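import Summits.BirchSwinnertonDyer.BirchSwinnertonDyer.Theorems.AdditiveBranchIMCMultLowerBranchTransport
import Literature.NumberTheory.EllipticCurves.Skinner2016.MultiplicativeMainConjecture
import HarnessLib

/-!
# Route `AdditiveBranchIMC` (rung K1), crux `MultLower` (item `stmt-BirchSwinnertonDyer-19359`):
# the displayed input (KV) of the branch transport IS Skinner 2016 Thm. A on the (irr)+(ram) rows

The branch transport on cell (M) (`AdditiveBranchIMCMultLowerBranchTransport{,Classes}.lean`) displays
two inputs at every multiplicative twist model `V` of the additive curve `E`: (KV) — Kato's direction
for `V` on the TRIVIAL branch, rational, strict Selmer group, `ι(X^e·h) = p^a·L_p(V,T)` with `e = 1`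
iff `V` is split at `p` — and (BC), the base-change product bound (not in print). THIS FILE records
that (KV) is PRINT on the rows of `V` with `V[p]` irreducible and a Steinberg prime `ℓ ≠ p` with
`p ∤ v_ℓ(Δ_min)` ((ram)): it is the rational shadow of the tree's named fact
`Skinner2016.thmA_charIdeal_multiplicative` (Skinner, Pacific J. Math. 283 (2016) Thm. A with §3.2's
factorisation `Ch_L(f) = Ch_L(f)'·(γ − 1)` at a split `p` and §3.3's period comparison), the period
ratio `ϖ_V` (`ϖ_V·Ω_V = Ω⁺_f`, a non-zero rational) being absorbed as `ϖ_V = p^v·w`, `w ∈ ℤ_p^×`.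
So on X4(M) ∩ {ρ̄ onto} ∩ (ram) the ONLY non-published inputs of the rank-`0` lower half of
`AdditiveBranchIMCMultLowerRankZero.lean` §3 are (BC) and the finite `μ = 0` certificate. Theorems only;
nothing asserted; cell (M) stays CONSTRUCTION-shaped; nothing booked.

References: Skinner, Pacific J. Math. 283 (2016) Thm. A, §3.2, §3.3 [Skinner2016PacificMC]; Kato,
Astérisque 295 (2004) Thm. 17.4 [Kato2004Asterisque]; Mazur–Tate–Teitelbaum 1986 §I.10, §I.13–I.14
[MazurTateTeitelbaum1986Invent].
-/

set_option autoImplicit false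
set_option linter.dupNamespace false

noncomputable section

open scoped Classical MatrixGroups ModularForm

namespace Summit.BirchSwinnertonDyer.BirchSwinnertonDyer.Theorems.AdditiveBranchIMCMultLower

open CongruenceSubgroup WeierstrassCurve Literature.NumberTheory.EllipticCurves
  Literature.NumberTheory.EllipticCurves.ModularForms
  Literature.NumberTheory.EllipticCurves.Rank1Residual

variable (p : ℕ) [hp : Fact p.Prime]

/-- **Absorbing a non-zero rational constant into a power of `p`.** If `g ∈ I` and
`ι(X^e·g) = C(ϖ)·L` with `ϖ ∈ ℚˣ`, then `ι(X^e·h) = C(p^a)·L` for some `h ∈ I`, `a ∈ ℕ`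
(`ϖ = p^v·w`, `w ∈ ℤ_p^×`; `h = C(w⁻¹·p^{(−v)⁺})·g`, `a = v⁺`). Bookkeeping. [folklore] -/
theorem exists_mem_iota_X_pow_mul_eq_C_pow_of_ratCast {I : Ideal (IwasawaAlgebra p)} {e : ℕ}
    {g : IwasawaAlgebra p} (hg : g ∈ I) {ϖ : ℚ} (hϖ0 : ϖ ≠ 0) {L : PowerSeries ℚ_[p]}
    (hι : iwasawaToPowerSeries p (PowerSeries.X ^ e * g) = PowerSeries.C ((ϖ : ℚ) : ℚ_[p]) * L) :
    ∃ (a : ℕ) (h : IwasawaAlgebra p), h ∈ I ∧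
      iwasawaToPowerSeries p (PowerSeries.X ^ e * h) = PowerSeries.C ((p : ℚ_[p]) ^ a) * L := by
  have hp0 : (p : ℚ_[p]) ≠ 0 := Nat.cast_ne_zero.mpr hp.out.ne_zero
  obtain ⟨v, w, hvw⟩ := exists_zpow_mul_units_eq_ratCast p hϖ0
  refine ⟨v.toNat, PowerSeries.C (((w⁻¹ : ℤ_[p]ˣ) : ℤ_[p]) * (p : ℤ_[p]) ^ (-v).toNat) * g,
    Ideal.mul_mem_left _ _ hg, ?_⟩
  have hvv : ((v.toNat : ℕ) : ℤ) = v + ((-v).toNat : ℕ) := by omega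
  have hpow : (p : ℚ_[p]) ^ v.toNat = (p : ℚ_[p]) ^ v * (p : ℚ_[p]) ^ (-v).toNat := by
    rw [← zpow_natCast, hvv, zpow_add₀ hp0, zpow_natCast]
  have hunit : (((w⁻¹ : ℤ_[p]ˣ) : ℤ_[p]) : ℚ_[p]) * ((w : ℤ_[p]) : ℚ_[p]) = 1 := by
    rw [← PadicInt.coe_mul, ← Units.val_mul, inv_mul_cancel]
    simp
  have hscal : (((w⁻¹ : ℤ_[p]ˣ) : ℤ_[p]) : ℚ_[p]) * (p : ℚ_[p]) ^ (-v).toNat *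
      ((p : ℚ_[p]) ^ v * ((w : ℤ_[p]) : ℚ_[p])) = (p : ℚ_[p]) ^ v * (p : ℚ_[p]) ^ (-v).toNat := by
    linear_combination ((p : ℚ_[p]) ^ v * (p : ℚ_[p]) ^ (-v).toNat) * hunit
  have hιC : iwasawaToPowerSeries p (PowerSeries.X ^ e *
      (PowerSeries.C (((w⁻¹ : ℤ_[p]ˣ) : ℤ_[p]) * (p : ℤ_[p]) ^ (-v).toNat) * g)) =
      PowerSeries.C ((((w⁻¹ : ℤ_[p]ˣ) : ℤ_[p]) * (p : ℤ_[p]) ^ (-v).toNat : ℤ_[p]) : ℚ_[p]) *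
        iwasawaToPowerSeries p (PowerSeries.X ^ e * g) := by
    rw [show PowerSeries.X ^ e * (PowerSeries.C (((w⁻¹ : ℤ_[p]ˣ) : ℤ_[p]) * (p : ℤ_[p]) ^ (-v).toNat)
      * g) = PowerSeries.C (((w⁻¹ : ℤ_[p]ˣ) : ℤ_[p]) * (p : ℤ_[p]) ^ (-v).toNat) *
      (PowerSeries.X ^ e * g) by ring, map_mul]
    simp only [iwasawaToPowerSeries, PowerSeries.map_C, PadicInt.algebraMap_apply]
  rw [hιC, hι, ← mul_assoc, ← map_mul, hvw, hpow]
  push_cast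
  rw [hscal]

/-- **(KV) from Skinner 2016 Thm. A (named fact `Skinner2016.thmA_charIdeal_multiplicative`).** For
`V/ℚ` globally minimal, `p ≥ 3` multiplicative for `V`, `V[p]` irreducible, (ram) (a multiplicative
prime `ℓ ≠ p` with `p ∤ v_ℓ(Δ_min)`), a newform `f` of `V` with `a_p(f) = ap` and a non-zero rational
period ratio `ϖ_V·Ω_V = Ω⁺_f`, a cyclotomic datum and a dual datum `DV` of `Sel_{p^∞}(V/ℚ_∞)`, and THE
`p`-adic `L`-function `L` of `IsMultPAdicLFunctionOf f p ap`: there are `a ∈ ℕ` and `h ∈ char X(V/ℚ_∞)`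
with `ι(X^e·h) = p^a·L`, `e = 1` at a split and `0` at a non-split `p` — the displayed input (KV) of
`isTorsion_and_charIdeal_eq_span_branchMult_of_katoV_of_baseChangeLower`, from print (indeed from the
EQUALITY `char X(V/ℚ_∞) = (g)`, `ι(T^e·g·w) = ϖ_V·L`). [cite: Skinner2016PacificMC, Thm. A (§1), §3.2, §3.3]
[cite: MazurTateTeitelbaum1986Invent, §I.10, §I.13–I.14] -/
theorem katoV_of_skinner2016 (hA : Skinner2016.thmA_charIdeal_multiplicative)
    {V : WeierstrassCurve ℚ} [V.IsElliptic] [V.IsGloballyMinimal] (hp3 : 3 ≤ p) (hV : Mult V p)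
    (hirr : Irr V p)
    (hram : ∃ ℓ : ℕ, ∃ _ : Fact ℓ.Prime, ℓ ≠ p ∧ V.HasMultiplicativeReductionAtPrime ℓ ∧
      ¬ p ∣ padicValInt ℓ V.minimalDiscriminantInt)
    {κ : ZpExtension ℚ p} {γ : Field.absoluteGaloisGroup ℚ} {N : ℕ} [NeZero N]
    {f : CuspForm (Gamma0 N) 2} (hκ : κ.IsCyclotomic) (hγ : κ.IsTopGenerator γ)
    (hcv : IsCyclotomicVariable p γ) (hf : IsNewformOf V f) {ap : ℤ} (hap : cuspCoeff f p = ap)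
    {ϖ : ℚ} (hϖ0 : ϖ ≠ 0) (hϖ : (ϖ : ℝ) * V.realPeriodRat = plusPeriod f)
    (DV : V.SelmerDualData κ γ) (L : PowerSeries ℚ_[p])
    (hL : IsMultPAdicLFunctionOf f p ((ap : ℤ) : ℚ_[p]) L) :
    ∃ (a : ℕ) (h : IwasawaAlgebra p), h ∈ DV.charIdeal ∧
      iwasawaToPowerSeries p
          (PowerSeries.X ^ (if V.HasSplitMultiplicativeReductionAtPrime p then 1 else 0) * h) =
        PowerSeries.C ((p : ℚ_[p]) ^ a) * L := by
  by_cases hs : V.HasSplitMultiplicativeReductionAtPrime p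
  · have hap1 : ap = 1 := by
      have h1 := (hf.cuspCoeff_eq_one_and_sq_of_split hs).1
      rw [hap] at h1
      exact_mod_cast h1
    subst hap1
    have hL' : IsSplitMultPAdicLFunctionOf f p L := by
      rw [← isMultPAdicLFunctionOf_one_iff]; simpa only [Int.cast_one] using hL
    obtain ⟨g, hg, hι⟩ := Skinner2016.thmA_charIdeal_multiplicative.exists_mem_charIdeal_split hA V p hp3
      hV hirr hram hκ hγ hcv hf DV ϖ hϖ0 hϖ hs L hL'
    rw [if_pos hs]
    exact exists_mem_iota_X_pow_mul_eq_C_pow_of_ratCast p hg hϖ0 (by rw [pow_one]; exact hι)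
  · have hap1 : ap = -1 := by
      have h1 := (hf.cuspCoeff_eq_neg_one_and_dvd_of_nonsplit hV hs).1
      rw [hap] at h1
      exact_mod_cast h1
    subst hap1
    have hL' : IsMultPAdicLFunctionOf f p (-1) L := by
      simpa only [Int.cast_neg, Int.cast_one] using hL
    obtain ⟨g, hg, hι⟩ := Skinner2016.thmA_charIdeal_multiplicative.exists_mem_charIdeal_nonsplit hA V p
      hp3 hV hirr hram hκ hγ hcv hf DV ϖ hϖ0 hϖ hs L hL'
    rw [if_neg hs]
    exact exists_mem_iota_X_pow_mul_eq_C_pow_of_ratCast p hg hϖ0 (by rw [pow_zero, one_mul]; exact hι)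

end Summit.BirchSwinnertonDyer.BirchSwinnertonDyer.Theorems.AdditiveBranchIMCMultLower

end
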